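import Summits.ResolutionOfSingularities.ResolutionOfSingularities.Theorems.PrimaryDeepSurfacePresentation
import Literature.AlgebraicGeometry.Resolution.NearPointColengthDropScheme
import Literature.AlgebraicGeometry.Resolution.PointBlowupOrderChart
import HarnessLib

/-!
# Primary deep cut — COLENGTH TRANSPORT (lens-4 g47, node «PrimaryDeepCut», slice S5)

§1 (λ↓)+(ν=) at ring level: along an injective presentation `ψ : chartRing c̄ j → S'` of a local ring `S'` as a
prime-localisation of a chart of the point blow-up of a two-dimensional regular local ring `S`, an `𝔪`-primary
ideal `C ⊆ 𝔪^e`, `C ⊄ 𝔪^(e+1)`, whose "saturated weak transform" `C' ⊆ 𝔪'^e` satisfies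
`ψ(c_j)^e·y ∈ ψ(C)S' ⇒ y ∈ C'`, has `λ(S'/C') < λ(S/C)` (Hironaka–Spivakovsky / Cutkosky–Piltant near-point
inequality, Literature `length_quotient_weakTransform_lt_of_near`) and `C' ⊄ 𝔪'^(e+1)`
(Literature `exists_weakTransform_chart_not_mem_pow`); the presentation need not be injective here — only
`IsLocalization.AtPrime` along `ψ` is consumed (`length_quotient_map_le_of_isLocalization`).
§2 `surface_chart_data`: at a point `x'` of the blow-up `π` of a REGULAR point `Z = 𝔪` lying on the strict transform of
the surface `K = (z ∘ castAdd 2)`, a transversal index `j = c + jb`, the prime-localised `z_j`-chart `χ` of `𝒪_{x'}`,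
the exceptional parameter `g = σ(z_j)`, the new frame `u' = χ(z_s/z_j)` with `(u', g)` part of a regular system of
parameters and `(u') = K'_{x'}`, and the controlled-transform membership test (g46 `chart_transport` with the chart
EXPORTED).  §3 the surface `R/𝔭`: its parameters generate `𝔪̄` and its embedding dimension is `2`.
-/

set_option linter.dupNamespace false

open CategoryTheory CategoryTheory.Limits AlgebraicGeometry TopologicalSpace IsLocalRing
open MvPolynomial Literature.AlgebraicGeometry.Resolution Scheme.IdealSheafData
open Summit.ResolutionOfSingularities.ResolutionOfSingularities.Theorems
open ForcedTowerClasses DivergentTowerClasses MonomialTowerClasses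
open HugDimensionClasses SurfaceShadowClasses SurfaceShadowKernels AbsoluteContactClasses
open Summit.ResolutionOfSingularities.ResolutionOfSingularities.Theses

universe u

namespace Summit.ResolutionOfSingularities.ResolutionOfSingularities.Theorems.HugValuationCut

/-! ## §1 Colength drop and order persistence along a surface-chart presentation -/

section SurfaceColength

variable {S : Type u} [CommRing S] [IsRegularLocalRing S] (hd : (maximalIdeal S).spanFinrank = 2)
  (c : Fin 2 → S) (hc : Ideal.span (Set.range c) = maximalIdeal S) (j : Fin 2)
  {S' : Type u} [CommRing S'] [IsLocalRing S'] (ψ : chartRing c j →+* S')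
  (𝔴' : Ideal (chartRing c j)) [𝔴'.IsPrime]

include hd hc in
/-- **(λ↓)+(ν=) COLENGTH DROP AND ORDER PERSISTENCE along a surface-chart presentation.** Let `S` be a regular local
ring of dimension two with regular parameters `c`, `S'` a local ring presented by an injective `ψ : chartRing c j → S'`
as the localisation at a prime `𝔴' ⊇ 𝔪_S` of the `c_j`-chart of the blow-up of the closed point, `C ⊆ 𝔪^e`
(`e ≥ 1`) an ideal of finite colength with `C ⊄ 𝔪^(e+1)`, and `C' ⊆ 𝔪'^e` an ideal of `S'` containing every `y`
with `ψ(c_j)^e·y ∈ ψ(C)S'`. Then `λ_{S'}(S'/C') < λ_S(S/C)` and `C' ⊄ 𝔪'^(e+1)`: the point `𝔴'` is NEAR because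
`C' ⊆ 𝔪'^e` pins every weak transform into `𝔪'^e`, so the Hironaka–Spivakovsky inequality applies, and the weak
transform of an element of order exactly `e` keeps order `≤ e`.
[cite: CossartPiltant2008, proof of Prop. 4.4, Prop. 4.2 (11)] [cite: HunekeSwanson2006, Lemma 14.3.4] -/
theorem length_lt_of_surfaceChart (hloc : @IsLocalization.AtPrime _ _ S' _ ψ.toAlgebra 𝔴' ‹_›)
    (h𝔴' : (maximalIdeal S).map (chartBase c j) ≤ 𝔴')
    {C : Ideal S} {e : ℕ} (he : 1 ≤ e) (hCe : C ≤ maximalIdeal S ^ e) (hCe' : ¬ C ≤ maximalIdeal S ^ (e + 1))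
    (hfin : IsFiniteLength S (S ⧸ C)) {C' : Ideal S'}
    (hC' : ∀ y, ψ (chartBase c j (c j)) ^ e * y ∈ C.map (ψ.comp (chartBase c j)) → y ∈ C')
    (hC'e : C' ≤ maximalIdeal S' ^ e) :
    Module.length S' (S' ⧸ C') < Module.length S (S ⧸ C) ∧ ¬ C' ≤ maximalIdeal S' ^ (e + 1) := by
  letI := ψ.toAlgebra
  haveI := hloc
  have hψa : (algebraMap (chartRing c j) S' : chartRing c j →+* S') = ψ := rfl
  have hx𝔴 : chartBase c j (c j) ∈ 𝔴' :=
    h𝔴' (Ideal.mem_map_of_mem _ (hc ▸ Ideal.subset_span ⟨j, rfl⟩ : c j ∈ maximalIdeal S))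
  -- weak transforms of members of `C` land in `C'`
  have hwt : ∀ {b : chartRing c j}, chartBase c j (c j) ^ e * b ∈ C.map (chartBase c j) → ψ b ∈ C' := by
    intro b hb
    refine hC' _ ?_
    rw [← map_pow, ← map_mul, ← Ideal.map_map]
    exact Ideal.mem_map_of_mem ψ hb
  -- NEARNESS of `𝔴'`: every weak transform `F(e)` lies in `𝔪'^e`
  have hnear : ∀ F : MvPolynomial (Fin 2) S, F.IsHomogeneous e → MvPolynomial.eval c F ∈ C →
      (algebraMap (chartRing c j) (Localization.AtPrime 𝔴') : chartRing c j →+* Localization.AtPrime 𝔴')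
        (MvPolynomial.eval₂Hom (chartBase c j) (fun i => chartGen c j i) F) ∈
        maximalIdeal (Localization.AtPrime 𝔴') ^ e := by
    intro F hF hFC
    by_contra hnot
    have h1 := algebraMap_not_mem_maximalIdeal_pow_of_isLocalization 𝔴' (S := S') hnot
    rw [hψa] at h1
    refine h1 (hC'e (hwt ?_))
    rw [← reesChartBase_eval_eq_pow_mul_eval₂ c j hF]
    exact Ideal.mem_map_of_mem _ hFC
  refine ⟨?_, ?_⟩
  · -- (λ↓)
    have hlt := length_quotient_weakTransform_lt_of_near hd c hc j he hCe hCe' hfin 𝔴' h𝔴' hnear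
    have hle := @length_quotient_map_le_of_isLocalization (chartRing c j) S' _ _ ψ.toAlgebra 𝔴' _ hloc
      ((C.map (chartBase c j)).colon {chartBase c j (c j) ^ e})
    rw [hψa] at hle
    have hJC : ((C.map (chartBase c j)).colon {chartBase c j (c j) ^ e}).map ψ ≤ C' := by
      rw [Ideal.map_le_iff_le_comap]
      intro b hb
      rw [Ideal.mem_comap]
      refine hwt ?_
      have h2 := Submodule.mem_colon_singleton.mp hb
      have h3 : chartBase c j (c j) ^ e * b = b • chartBase c j (c j) ^ e := mul_comm (chartBase c j (c j) ^ e) b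
      rw [h3]
      exact h2
    exact ((Module.length_le_of_surjective (Submodule.factor hJC) (Submodule.factor_surjective hJC)).trans
      hle).trans_lt hlt
  · -- (ν=)
    intro hC'e1
    obtain ⟨f, hfC, hfe1⟩ := Set.not_subset.mp hCe'
    obtain ⟨f', hff', hf'⟩ := exists_weakTransform_chart_not_mem_pow hd c hc j (hCe hfC) hfe1 𝔴' hx𝔴
    have h1 := algebraMap_not_mem_maximalIdeal_pow_of_isLocalization 𝔴' (S := S') hf'
    rw [hψa] at h1
    refine h1 (hC'e1 (hwt ?_))
    rw [← hff']
    exact Ideal.mem_map_of_mem _ hfC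

end SurfaceColength

/-! ## §2 Surface chart data at a point of the blow-up of a regular point -/

/-- An index of `Fin (m + n)` outside the range of `Fin.castAdd n` is of the form `Fin.natAdd m i`. -/
theorem exists_natAdd_eq_of_not_mem_range {m n : ℕ} (j : Fin (m + n))
    (hj : j ∉ Set.range (Fin.castAdd n : Fin m → Fin (m + n))) : ∃ i : Fin n, Fin.natAdd m i = j := by
  induction j using Fin.addCases with
  | left i => exact absurd ⟨i, rfl⟩ hj
  | right i => exact ⟨i, rfl⟩

section PointStep

variable {X X' : Scheme.{0}} [IsLocallyNoetherian X'] (π : X' ⟶ X) (Z K D : X.IdealSheafData)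

set_option maxHeartbeats 400000 in
/-- **SURFACE CHART DATA** (the chart of g46 `chart_transport`, exported).  `π` the blow-up of `Z` with
`Z_{π x'} = 𝔪` (a regular point of embedding dimension `c + 2`), `z` a regular system of parameters at `π x'` whose
first `c` members `z ∘ castAdd 2` generate the stalk `K_{π x'}` (a germ of regular SURFACE), and `x'` a point of the
strict transform of `K`.  Then `𝒪_{x'} = 𝒪[𝔪/z_j]_𝔴` for a BASE index `j = natAdd c jb` (`jb : Fin 2`), through an
explicit chart map `χ` presenting `𝒪_{x'}` as the localisation of the Rees chart at a prime `𝔴 ⊇ 𝔪` containing the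
surface chart generators; `g = σ(z_j)` is a nonzerodivisor with `σ(z_t) = g·χ(z_t/z_j)`; `(χ(z_s/z_j))_{s<c}, g` is
part of a regular system of parameters; `(χ(z_s/z_j))_{s<c}` IS the strict-transform stalk of `K`; and the
controlled transform of `D` (control `n`) is `(σ(D)𝒪_{x'} : g^n)`.
[cite: Hironaka1964, Ch. III §3 Lemma 6 p. 238; StacksProject, Tag 0804; Matsumura1987, Thm. 14.2] -/
theorem surface_chart_data (hπ : IsBlowup π Z) (x' : X') [IsRegularLocalRing (X.presheaf.stalk (π.base x'))]
    (hZ : stalkIdeal Z (π.base x') = maximalIdeal _) {c : ℕ} (z : Fin (c + 2) → X.presheaf.stalk (π.base x'))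
    (hz : Ideal.span (Set.range z) = maximalIdeal _)
    (hrank : (maximalIdeal (X.presheaf.stalk (π.base x'))).spanFinrank = c + 2)
    (hK : Ideal.span (Set.range (z ∘ Fin.castAdd 2)) = stalkIdeal K (π.base x'))
    (hx' : x' ∈ ((strictTransformIdeal π Z K).support : Set X')) (n : ℕ) :
    ∃ (jb : Fin 2) (𝔴 : PrimeSpectrum (chartRing z (Fin.natAdd c jb)))
      (χ : chartRing z (Fin.natAdd c jb) →+* X'.presheaf.stalk x'),
      (∀ a, χ (chartBase z (Fin.natAdd c jb) a) = (π.stalkMap x').hom a) ∧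
      @IsLocalization.AtPrime _ _ (X'.presheaf.stalk x') _ χ.toAlgebra 𝔴.asIdeal _ ∧
      𝔴.asIdeal.comap (chartBase z (Fin.natAdd c jb)) = maximalIdeal _ ∧
      (∀ s : Fin c, chartGen z (Fin.natAdd c jb) (Fin.castAdd 2 s) ∈ 𝔴.asIdeal) ∧
      (π.stalkMap x').hom (z (Fin.natAdd c jb)) ∈ nonZeroDivisors _ ∧
      (∀ t, (π.stalkMap x').hom (z t) =
        (π.stalkMap x').hom (z (Fin.natAdd c jb)) * χ (chartGen z (Fin.natAdd c jb) t)) ∧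
      IsRsopPart (Fin.snoc (fun s : Fin c => χ (chartGen z (Fin.natAdd c jb) (Fin.castAdd 2 s)))
        ((π.stalkMap x').hom (z (Fin.natAdd c jb))) : Fin (c + 1) → _) ∧
      Ideal.span (Set.range fun s : Fin c => χ (chartGen z (Fin.natAdd c jb) (Fin.castAdd 2 s))) =
        stalkIdeal (strictTransformIdeal π Z K) x' ∧
      (∀ y, y ∈ stalkIdeal (controlledTransform π Z D n) x' ↔
        (π.stalkMap x').hom (z (Fin.natAdd c jb)) ^ n * y ∈
          (stalkIdeal D (π.base x')).map (π.stalkMap x').hom) := by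
  have h𝔭'le : stalkIdeal (strictTransformIdeal π Z K) x' ≤ maximalIdeal _ :=
    (mem_support_iff_stalkIdeal_le _ _).mp hx'
  have hc' : Ideal.span (Set.range z) = stalkIdeal Z (π.base x') := by rw [hZ]; exact hz
  obtain ⟨j, 𝔴, χ, hχ, hloc, h𝔴⟩ := hπ.exists_reesChart_stalk x' z hc'
  letI := χ.toAlgebra
  haveI : IsLocalization.AtPrime (X'.presheaf.stalk x') 𝔴.asIdeal := hloc
  have hχa : (algebraMap (chartRing z j) (X'.presheaf.stalk x') : _ →+* _) = χ := RingHom.algebraMap_toAlgebra χ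
  -- the chart generators `e_t` and the exceptional parameter `g = σ(z_j)`
  let e : Fin (c + 2) → X'.presheaf.stalk x' := fun t => χ (chartGen z j t)
  have hzt : ∀ t, (π.stalkMap x').hom (z t) = (π.stalkMap x').hom (z j) * e t := fun t => by
    rw [← hχ, ← hχ, reesChartBase_apply_eq_mul_chartGen z j t, map_mul]
  have hgnzd : (π.stalkMap x').hom (z j) ∈ nonZeroDivisors _ := by
    have h1 : (π.stalkMap x').hom (z j) =
        (algebraMap (chartRing z j) (X'.presheaf.stalk x') : chartRing z j →+* _) (chartBase z j (z j)) := by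
      rw [hχa, hχ]
    rw [h1]
    exact IsLocalization.nonZeroDivisors_le_comap 𝔴.asIdeal.primeCompl (X'.presheaf.stalk x')
      (reesChartBase_mem_nonZeroDivisors _ _)
  have hE : stalkIdeal (Z.comap π) x' = Ideal.span {(π.stalkMap x').hom (z j)} := by
    rw [stalkIdeal_comap_eq_map_stalkMap, ← hc', Ideal.map_span]
    apply le_antisymm
    · rw [Ideal.span_le]
      rintro _ ⟨_, ⟨l, rfl⟩, rfl⟩
      rw [SetLike.mem_coe, Ideal.mem_span_singleton']
      exact ⟨e l, by rw [mul_comm]; exact (hzt l).symm⟩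
    · exact (Ideal.span_singleton_le_iff_mem _).mpr (Ideal.subset_span ⟨z j, ⟨j, rfl⟩, rfl⟩)
  have hst : stalkIdeal (strictTransformIdeal π Z K) x' =
      stOp (π.stalkMap x').hom (Ideal.span {(π.stalkMap x').hom (z j)}) (stalkIdeal K (π.base x')) := by
    rw [stalkIdeal_strictTransformIdeal_eq_stOp, hE]
  have hzK : ∀ s : Fin c, z (Fin.castAdd 2 s) ∈ stalkIdeal K (π.base x') := fun s => by
    rw [← hK]; exact Ideal.subset_span ⟨s, rfl⟩
  -- (i) `e_{castAdd 2 s}` lies on the strict transform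
  have he𝔭' : ∀ s : Fin c, e (Fin.castAdd 2 s) ∈ stalkIdeal (strictTransformIdeal π Z K) x' := fun s => by
    rw [hst, mem_stOp_iff]
    refine ⟨1, ?_⟩
    rw [pow_one, Ideal.span_singleton_mul_span_singleton, Ideal.span_singleton_le_iff_mem, mul_comm, ← hzt]
    exact Ideal.mem_map_of_mem _ (hzK s)
  -- (ii) hence the chart generator `chartGen (castAdd 2 s)` lies in `𝔴`
  have h𝔴t : ∀ s : Fin c, chartGen z j (Fin.castAdd 2 s) ∈ 𝔴.asIdeal := fun s => by
    have h1 : (algebraMap (chartRing z j) (X'.presheaf.stalk x') : chartRing z j →+* _)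
        (chartGen z j (Fin.castAdd 2 s)) ∈ maximalIdeal _ := by
      rw [hχa]; exact h𝔭'le (he𝔭' s)
    exact (IsLocalization.AtPrime.to_map_mem_maximal_iff (X'.presheaf.stalk x') 𝔴.asIdeal _).mp h1
  -- (iii) the exceptional index is not a `K`-index: it is a base index `natAdd c jb`
  have hj : j ∉ Set.range (Fin.castAdd 2 : Fin c → Fin (c + 2)) := by
    rintro ⟨s, hs⟩
    have hjj : chartGen z j j = 1 := chartGen_self z j
    have h1 : e (Fin.castAdd 2 s) = 1 := by
      show χ (chartGen z j (Fin.castAdd 2 s)) = 1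
      rw [hs, hjj, map_one]
    have h2 := he𝔭' s
    rw [h1] at h2
    exact (maximalIdeal.isMaximal _).ne_top (Ideal.eq_top_of_isUnit_mem _ (h𝔭'le h2) isUnit_one)
  obtain ⟨jb, hjb⟩ := exists_natAdd_eq_of_not_mem_range j hj
  subst hjb
  -- (iv) the regular-parameter family `(e ∘ castAdd 2, g)` read off the chart
  have hzw : Ideal.span (Set.range (Fin.append z (fun i : Fin 0 => i.elim0))) =
      maximalIdeal (X.presheaf.stalk (π.base x')) := by
    rw [range_fin_append, Set.range_eq_empty (fun i : Fin 0 => _), Set.union_empty, hz]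
  have hd0 : (maximalIdeal (X.presheaf.stalk (π.base x'))).spanFinrank = c + 2 + 0 := hrank
  have hsnoc : IsRsopPart (Fin.snoc (fun s : Fin c => e (Fin.castAdd 2 s))
      ((π.stalkMap x').hom (z (Fin.natAdd c jb))) : Fin (c + 1) → _) := by
    have hjne : ∀ s : Fin c, Fin.castAdd 2 s ≠ Fin.natAdd c jb := fun s h => hj ⟨s, h⟩
    have hfam := isRsopPart_chartFamily_reesChart z (Fin.natAdd c jb) (fun i : Fin 0 => i.elim0) hzw hd0
      𝔴.asIdeal h𝔴 (X'.presheaf.stalk x') (fun s => (⟨Fin.castAdd 2 s, hjne s⟩ : {t // t ≠ Fin.natAdd c jb}))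
      (fun a b h => Fin.castAdd_injective _ _ (congrArg Subtype.val h)) h𝔴t
    have heq : chartFamily z (Fin.natAdd c jb) (fun i : Fin 0 => i.elim0) (X'.presheaf.stalk x')
        (chartBase z (Fin.natAdd c jb)) (chartGen z (Fin.natAdd c jb))
        (fun s => (⟨Fin.castAdd 2 s, hjne s⟩ : {t // t ≠ Fin.natAdd c jb})) =
        (Fin.cons ((π.stalkMap x').hom (z (Fin.natAdd c jb))) (fun s : Fin c => e (Fin.castAdd 2 s)) :
          Fin (c + 0 + 1) → _) := by
      funext i
      refine Fin.cases ?_ (fun k => ?_) i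
      · simp only [chartFamily, Fin.cons_zero, hχa, hχ]
      · simp only [chartFamily, Fin.cons_succ]
        show _ = χ (chartGen z (Fin.natAdd c jb) (Fin.castAdd 2 k))
        rw [← hχa]
        exact Fin.append_left
          (fun s : Fin c => (algebraMap (chartRing z (Fin.natAdd c jb)) (X'.presheaf.stalk x') :
            chartRing z (Fin.natAdd c jb) →+* _) (chartGen z (Fin.natAdd c jb) (Fin.castAdd 2 s))) _ k
    rw [heq] at hfam
    have h2 := hfam.comp (finRotate (c + 1)) (finRotate _).injective
    rw [Function.comp_def, ← Fin.snoc_eq_cons_rotate] at h2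
    exact h2
  -- (v) `𝔭' = (u')`
  have h𝔭' : Ideal.span (Set.range fun s : Fin c => e (Fin.castAdd 2 s)) =
      stalkIdeal (strictTransformIdeal π Z K) x' := by
    apply le_antisymm
    · rw [Ideal.span_le]
      rintro _ ⟨s, rfl⟩
      exact he𝔭' s
    · intro y hy
      rw [hst, mem_stOp_iff] at hy
      obtain ⟨N, hN⟩ := hy
      have hKmap : (stalkIdeal K (π.base x')).map (π.stalkMap x').hom ≤
          Ideal.span {(π.stalkMap x').hom (z (Fin.natAdd c jb))} *
            Ideal.span (Set.range fun s : Fin c => e (Fin.castAdd 2 s)) := by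
        rw [← hK, Ideal.map_span, Ideal.span_le]
        rintro _ ⟨_, ⟨s, rfl⟩, rfl⟩
        rw [SetLike.mem_coe, Function.comp_apply, hzt (Fin.castAdd 2 s)]
        exact Ideal.mul_mem_mul (Ideal.mem_span_singleton_self _)
          (Ideal.subset_span (s := Set.range fun s : Fin c => e (Fin.castAdd 2 s)) (Set.mem_range_self s))
      have h1 : y * (π.stalkMap x').hom (z (Fin.natAdd c jb)) ^ N ∈
          Ideal.span {(π.stalkMap x').hom (z (Fin.natAdd c jb))} *
            Ideal.span (Set.range fun s : Fin c => e (Fin.castAdd 2 s)) := by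
        refine hKmap (hN ?_)
        rw [Ideal.span_singleton_pow, Ideal.span_singleton_mul_span_singleton]
        exact Ideal.mem_span_singleton_self _
      rcases N with _ | N
      · rw [pow_zero, mul_one] at h1
        exact Ideal.mul_le_left h1
      · rw [pow_succ, ← mul_assoc, mul_comm (y * _)] at h1
        have h2 := mem_of_mul_mem_span_singleton_mul _ hgnzd h1
        rw [mul_comm] at h2
        exact mem_span_of_pow_mul_mem hsnoc h2
  -- (vi) the controlled transform of `D`
  have hI' : ∀ y, y ∈ stalkIdeal (controlledTransform π Z D n) x' ↔
      (π.stalkMap x').hom (z (Fin.natAdd c jb)) ^ n * y ∈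
        (stalkIdeal D (π.base x')).map (π.stalkMap x').hom := by
    intro y
    rw [hπ.stalkIdeal_controlledTransform D n x', hE, stalkIdeal_comap_eq_map_stalkMap,
      ← span_singleton_mul_le_iff_mem_colon, Ideal.span_singleton_pow, Ideal.span_singleton_mul_span_singleton,
      Ideal.span_singleton_le_iff_mem, mul_comm]
  exact ⟨jb, 𝔴, χ, hχ, hloc, h𝔴, h𝔴t, hgnzd, hzt, hsnoc, h𝔭', hI'⟩

end PointStep

/-! ## §3 The surface `R/𝔭`: parameters and embedding dimension -/

section Surface

variable {R : Type u} [CommRing R] [IsLocalRing R] {c : ℕ} (z : Fin (c + 2) → R)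

/-- the surface parameters generate the maximal ideal of the surface `R/𝔭`, `𝔭 = (z_s : s < c)`, when `z` generates
`𝔪`. [cite: Matsumura1987, Thm. 14.2] -/
theorem span_range_surfParam [IsLocalRing (R ⧸ surfIdeal z)] (hz : Ideal.span (Set.range z) = maximalIdeal R) :
    Ideal.span (Set.range (surfParam z)) = maximalIdeal (R ⧸ surfIdeal z) := by
  rw [← map_maximalIdeal_of_surjective (Ideal.Quotient.mk (surfIdeal z)) Ideal.Quotient.mk_surjective, ← hz,
    Ideal.map_span]
  apply le_antisymm
  · rw [Ideal.span_le]
    rintro _ ⟨i, rfl⟩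
    exact Ideal.subset_span ⟨z (Fin.natAdd c i), ⟨Fin.natAdd c i, rfl⟩, rfl⟩
  · rw [Ideal.span_le]
    rintro _ ⟨_, ⟨t, rfl⟩, rfl⟩
    rw [SetLike.mem_coe]
    induction t using Fin.addCases with
    | left s =>
      have h0 : Ideal.Quotient.mk (surfIdeal z) (z (Fin.castAdd 2 s)) = 0 :=
        Ideal.Quotient.eq_zero_iff_mem.mpr (Ideal.subset_span ⟨s, rfl⟩)
      rw [h0]
      exact zero_mem _
    | right i => exact Ideal.subset_span ⟨i, rfl⟩

end Surface

section SurfaceRank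

variable {R : Type u} [CommRing R] [IsRegularLocalRing R] {c : ℕ} (z : Fin (c + 2) → R)

/-- the surface `R/𝔭` (`𝔭 = (z_s : s < c)`, `z` a regular system of parameters of `R`) has embedding dimension `2`.
[cite: Matsumura1987, Thm. 14.2] -/
theorem spanFinrank_maximalIdeal_surface [IsRegularLocalRing (R ⧸ surfIdeal z)]
    (hz : Ideal.span (Set.range z) = maximalIdeal R) (hd : (maximalIdeal R).spanFinrank = c + 2) :
    (maximalIdeal (R ⧸ surfIdeal z)).spanFinrank = 2 := by
  have hu : IsRsopPart (z ∘ Fin.castAdd 2) := (isRsopPart_full z hz hd).comp (Fin.castAdd 2) (Fin.castAdd_injective _ _)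
  have h1 := IsRegularLocalRing.spanFinrank_maximalIdeal (R := R ⧸ surfIdeal z)
  have h2 : ringKrullDim (R ⧸ surfIdeal z) + (c : WithBot ℕ∞) = ringKrullDim R := hu.ringKrullDim_quotient_add
  have h3 := IsRegularLocalRing.spanFinrank_maximalIdeal (R := R)
  rw [hd] at h3
  rw [← h3, ← h1] at h2
  have h4 : (maximalIdeal (R ⧸ surfIdeal z)).spanFinrank + c = c + 2 := by exact_mod_cast h2
  omega

end SurfaceRank

end Summit.ResolutionOfSingularities.ResolutionOfSingularities.Theorems.HugValuationCut
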